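import Mathlib
import Summits.Ventures.PercRepro.PuncturedLYMTriplesSymPos

/-!
# PercRepro — (SP) FOR THREE PAIRWISE DISJOINT TRIPLES AT LEVEL 4 ON EVERY GROUND SET: THE ROW EQUATIONS B (TYPES 13–23)
(p10, gen 39)

The 23 row equations of the certificate: for every row type `(a₁, a₂, a₃)` (free count `4 − Σ a_i`) the weights of
the `3 − a_i` columns in the direction of member `i` and of the `m + 5 − aF` free columns add up to `#Y/#P` (entries) —
i.e. to `1/#P` for the normalised type weights `W`. Proved as rational-function identities in `m`. Nothing here asserts (SP).
-/

namespace PercRepro.PuncturedLYM.Split.TypeLift.TriplesSym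

open Finset

/-- The row equation of the type `(1, 1, 0)` (free count `2`), in the entries. -/
theorem row_1_1_0 (m : ℚ) (hm : 0 ≤ m) : 2 * e_1_H m + 2 * e_1_1_H m + 3 * e_1_1_0_H m + (m + 3) * e_1_1_0_F m = Y m / P m := by
  unfold e_1_1_0_F e_1_1_0_H e_1_1_H e_1_H Y P
  field_simp
  ring

/-- The row equation of the type `(1, 1, 0)`, in the type weights. -/
theorem rowW_1_1_0 (m : ℚ) (hm : 0 ≤ m) :
    ((3 - 1 : ℕ) : ℚ) * W m ![1, 1, 0] 2 (some 0) +
      ((3 - 1 : ℕ) : ℚ) * W m ![1, 1, 0] 2 (some 1) +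
      ((3 - 0 : ℕ) : ℚ) * W m ![1, 1, 0] 2 (some 2) +
      (m + 5 - ((2 : ℕ) : ℚ)) * W m ![1, 1, 0] 2 none = 1 / P m := by
  have key := row_1_1_0 m hm
  have hY := Y_pos m hm
  have hP := P_pos m hm
  simp (config := {decide := true}) only [W, h1, h2, h3, hF, if_true, if_false]
  rw [eq_div_iff hP.ne'] at key
  field_simp
  linear_combination key

/-- The row equation of the type `(1, 1, 1)` (free count `1`), in the entries. -/
theorem row_1_1_1 (m : ℚ) (hm : 0 ≤ m) : 2 * e_1_H m + 2 * e_1_1_H m + 2 * e_1_1_1_H m + (m + 4) * e_1_1_1_F m = Y m / P m := by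
  unfold e_1_1_1_F e_1_1_1_H e_1_1_H e_1_H Y P
  field_simp
  ring

/-- The row equation of the type `(1, 1, 1)`, in the type weights. -/
theorem rowW_1_1_1 (m : ℚ) (hm : 0 ≤ m) :
    ((3 - 1 : ℕ) : ℚ) * W m ![1, 1, 1] 1 (some 0) +
      ((3 - 1 : ℕ) : ℚ) * W m ![1, 1, 1] 1 (some 1) +
      ((3 - 1 : ℕ) : ℚ) * W m ![1, 1, 1] 1 (some 2) +
      (m + 5 - ((1 : ℕ) : ℚ)) * W m ![1, 1, 1] 1 none = 1 / P m := by
  have key := row_1_1_1 m hm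
  have hY := Y_pos m hm
  have hP := P_pos m hm
  simp (config := {decide := true}) only [W, h1, h2, h3, hF, if_true, if_false]
  rw [eq_div_iff hP.ne'] at key
  field_simp
  linear_combination key

/-- The row equation of the type `(1, 1, 2)` (free count `0`), in the entries. -/
theorem row_1_1_2 (m : ℚ) (hm : 0 ≤ m) : 2 * e_1_H m + 2 * e_1_1_H m + 1 * e_1_1_2_H m + (m + 5) * e_1_1_2_F m = Y m / P m := by
  unfold e_1_1_2_F e_1_1_2_H e_1_1_H e_1_H Y P
  field_simp
  ring

/-- The row equation of the type `(1, 1, 2)`, in the type weights. -/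
theorem rowW_1_1_2 (m : ℚ) (hm : 0 ≤ m) :
    ((3 - 1 : ℕ) : ℚ) * W m ![1, 1, 2] 0 (some 0) +
      ((3 - 1 : ℕ) : ℚ) * W m ![1, 1, 2] 0 (some 1) +
      ((3 - 2 : ℕ) : ℚ) * W m ![1, 1, 2] 0 (some 2) +
      (m + 5 - ((0 : ℕ) : ℚ)) * W m ![1, 1, 2] 0 none = 1 / P m := by
  have key := row_1_1_2 m hm
  have hY := Y_pos m hm
  have hP := P_pos m hm
  simp (config := {decide := true}) only [W, h1, h2, h3, hF, if_true, if_false]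
  rw [eq_div_iff hP.ne'] at key
  field_simp
  linear_combination key

/-- The row equation of the type `(1, 2, 0)` (free count `1`), in the entries. -/
theorem row_1_2_0 (m : ℚ) (hm : 0 ≤ m) : 2 * e_1_H m + 1 * e_1_2_H m + 3 * e_1_2_F m + (m + 4) * e_1_2_F m = Y m / P m := by
  unfold e_1_2_F e_1_2_H e_1_H Y P
  field_simp
  ring

/-- The row equation of the type `(1, 2, 0)`, in the type weights. -/
theorem rowW_1_2_0 (m : ℚ) (hm : 0 ≤ m) :
    ((3 - 1 : ℕ) : ℚ) * W m ![1, 2, 0] 1 (some 0) +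
      ((3 - 2 : ℕ) : ℚ) * W m ![1, 2, 0] 1 (some 1) +
      ((3 - 0 : ℕ) : ℚ) * W m ![1, 2, 0] 1 (some 2) +
      (m + 5 - ((1 : ℕ) : ℚ)) * W m ![1, 2, 0] 1 none = 1 / P m := by
  have key := row_1_2_0 m hm
  have hY := Y_pos m hm
  have hP := P_pos m hm
  simp (config := {decide := true}) only [W, h1, h2, h3, hF, if_true, if_false]
  rw [eq_div_iff hP.ne'] at key
  field_simp
  linear_combination key

/-- The row equation of the type `(1, 2, 1)` (free count `0`), in the entries. -/
theorem row_1_2_1 (m : ℚ) (hm : 0 ≤ m) : 2 * e_1_H m + 1 * e_1_2_H m + 2 * e_1_2_F m + (m + 5) * e_1_2_F m = Y m / P m := by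
  unfold e_1_2_F e_1_2_H e_1_H Y P
  field_simp
  ring

/-- The row equation of the type `(1, 2, 1)`, in the type weights. -/
theorem rowW_1_2_1 (m : ℚ) (hm : 0 ≤ m) :
    ((3 - 1 : ℕ) : ℚ) * W m ![1, 2, 1] 0 (some 0) +
      ((3 - 2 : ℕ) : ℚ) * W m ![1, 2, 1] 0 (some 1) +
      ((3 - 1 : ℕ) : ℚ) * W m ![1, 2, 1] 0 (some 2) +
      (m + 5 - ((0 : ℕ) : ℚ)) * W m ![1, 2, 1] 0 none = 1 / P m := by
  have key := row_1_2_1 m hm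
  have hY := Y_pos m hm
  have hP := P_pos m hm
  simp (config := {decide := true}) only [W, h1, h2, h3, hF, if_true, if_false]
  rw [eq_div_iff hP.ne'] at key
  field_simp
  linear_combination key

/-- The row equation of the type `(2, 0, 0)` (free count `2`), in the entries. -/
theorem row_2_0_0 (m : ℚ) (hm : 0 ≤ m) : 1 * e_2_H m + 3 * e_2_0_H m + 3 * e_2_0_0_H m + (m + 3) * e_2_0_0_F m = Y m / P m := by
  unfold e_2_0_0_F e_2_0_0_H e_2_0_H e_2_H Y P
  field_simp
  ring

/-- The row equation of the type `(2, 0, 0)`, in the type weights. -/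
theorem rowW_2_0_0 (m : ℚ) (hm : 0 ≤ m) :
    ((3 - 2 : ℕ) : ℚ) * W m ![2, 0, 0] 2 (some 0) +
      ((3 - 0 : ℕ) : ℚ) * W m ![2, 0, 0] 2 (some 1) +
      ((3 - 0 : ℕ) : ℚ) * W m ![2, 0, 0] 2 (some 2) +
      (m + 5 - ((2 : ℕ) : ℚ)) * W m ![2, 0, 0] 2 none = 1 / P m := by
  have key := row_2_0_0 m hm
  have hY := Y_pos m hm
  have hP := P_pos m hm
  simp (config := {decide := true}) only [W, h1, h2, h3, hF, if_true, if_false]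
  rw [eq_div_iff hP.ne'] at key
  field_simp
  linear_combination key

/-- The row equation of the type `(2, 0, 1)` (free count `1`), in the entries. -/
theorem row_2_0_1 (m : ℚ) (hm : 0 ≤ m) : 1 * e_2_H m + 3 * e_2_0_H m + 2 * e_2_0_1_H m + (m + 4) * e_2_0_1_F m = Y m / P m := by
  unfold e_2_0_1_F e_2_0_1_H e_2_0_H e_2_H Y P
  field_simp
  ring

/-- The row equation of the type `(2, 0, 1)`, in the type weights. -/
theorem rowW_2_0_1 (m : ℚ) (hm : 0 ≤ m) :
    ((3 - 2 : ℕ) : ℚ) * W m ![2, 0, 1] 1 (some 0) +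
      ((3 - 0 : ℕ) : ℚ) * W m ![2, 0, 1] 1 (some 1) +
      ((3 - 1 : ℕ) : ℚ) * W m ![2, 0, 1] 1 (some 2) +
      (m + 5 - ((1 : ℕ) : ℚ)) * W m ![2, 0, 1] 1 none = 1 / P m := by
  have key := row_2_0_1 m hm
  have hY := Y_pos m hm
  have hP := P_pos m hm
  simp (config := {decide := true}) only [W, h1, h2, h3, hF, if_true, if_false]
  rw [eq_div_iff hP.ne'] at key
  field_simp
  linear_combination key

/-- The row equation of the type `(2, 0, 2)` (free count `0`), in the entries. -/
theorem row_2_0_2 (m : ℚ) (hm : 0 ≤ m) : 1 * e_2_H m + 3 * e_2_0_H m + 1 * e_2_0_2_H m + (m + 5) * e_2_0_2_F m = Y m / P m := by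
  unfold e_2_0_2_F e_2_0_2_H e_2_0_H e_2_H Y P
  field_simp
  ring

/-- The row equation of the type `(2, 0, 2)`, in the type weights. -/
theorem rowW_2_0_2 (m : ℚ) (hm : 0 ≤ m) :
    ((3 - 2 : ℕ) : ℚ) * W m ![2, 0, 2] 0 (some 0) +
      ((3 - 0 : ℕ) : ℚ) * W m ![2, 0, 2] 0 (some 1) +
      ((3 - 2 : ℕ) : ℚ) * W m ![2, 0, 2] 0 (some 2) +
      (m + 5 - ((0 : ℕ) : ℚ)) * W m ![2, 0, 2] 0 none = 1 / P m := by
  have key := row_2_0_2 m hm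
  have hY := Y_pos m hm
  have hP := P_pos m hm
  simp (config := {decide := true}) only [W, h1, h2, h3, hF, if_true, if_false]
  rw [eq_div_iff hP.ne'] at key
  field_simp
  linear_combination key

/-- The row equation of the type `(2, 1, 0)` (free count `1`), in the entries. -/
theorem row_2_1_0 (m : ℚ) (hm : 0 ≤ m) : 1 * e_2_H m + 2 * e_2_1_H m + 3 * e_2_1_F m + (m + 4) * e_2_1_F m = Y m / P m := by
  unfold e_2_1_F e_2_1_H e_2_H Y P
  field_simp
  ring

/-- The row equation of the type `(2, 1, 0)`, in the type weights. -/
theorem rowW_2_1_0 (m : ℚ) (hm : 0 ≤ m) :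
    ((3 - 2 : ℕ) : ℚ) * W m ![2, 1, 0] 1 (some 0) +
      ((3 - 1 : ℕ) : ℚ) * W m ![2, 1, 0] 1 (some 1) +
      ((3 - 0 : ℕ) : ℚ) * W m ![2, 1, 0] 1 (some 2) +
      (m + 5 - ((1 : ℕ) : ℚ)) * W m ![2, 1, 0] 1 none = 1 / P m := by
  have key := row_2_1_0 m hm
  have hY := Y_pos m hm
  have hP := P_pos m hm
  simp (config := {decide := true}) only [W, h1, h2, h3, hF, if_true, if_false]
  rw [eq_div_iff hP.ne'] at key
  field_simp
  linear_combination key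

/-- The row equation of the type `(2, 1, 1)` (free count `0`), in the entries. -/
theorem row_2_1_1 (m : ℚ) (hm : 0 ≤ m) : 1 * e_2_H m + 2 * e_2_1_H m + 2 * e_2_1_F m + (m + 5) * e_2_1_F m = Y m / P m := by
  unfold e_2_1_F e_2_1_H e_2_H Y P
  field_simp
  ring

/-- The row equation of the type `(2, 1, 1)`, in the type weights. -/
theorem rowW_2_1_1 (m : ℚ) (hm : 0 ≤ m) :
    ((3 - 2 : ℕ) : ℚ) * W m ![2, 1, 1] 0 (some 0) +
      ((3 - 1 : ℕ) : ℚ) * W m ![2, 1, 1] 0 (some 1) +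
      ((3 - 1 : ℕ) : ℚ) * W m ![2, 1, 1] 0 (some 2) +
      (m + 5 - ((0 : ℕ) : ℚ)) * W m ![2, 1, 1] 0 none = 1 / P m := by
  have key := row_2_1_1 m hm
  have hY := Y_pos m hm
  have hP := P_pos m hm
  simp (config := {decide := true}) only [W, h1, h2, h3, hF, if_true, if_false]
  rw [eq_div_iff hP.ne'] at key
  field_simp
  linear_combination key

/-- The row equation of the type `(2, 2, 0)` (free count `0`), in the entries. -/
theorem row_2_2_0 (m : ℚ) (hm : 0 ≤ m) : 1 * e_2_H m + 1 * e_2_2_H m + 3 * e_2_2_F m + (m + 5) * e_2_2_F m = Y m / P m := by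
  unfold e_2_2_F e_2_2_H e_2_H Y P
  field_simp
  ring

/-- The row equation of the type `(2, 2, 0)`, in the type weights. -/
theorem rowW_2_2_0 (m : ℚ) (hm : 0 ≤ m) :
    ((3 - 2 : ℕ) : ℚ) * W m ![2, 2, 0] 0 (some 0) +
      ((3 - 2 : ℕ) : ℚ) * W m ![2, 2, 0] 0 (some 1) +
      ((3 - 0 : ℕ) : ℚ) * W m ![2, 2, 0] 0 (some 2) +
      (m + 5 - ((0 : ℕ) : ℚ)) * W m ![2, 2, 0] 0 none = 1 / P m := by
  have key := row_2_2_0 m hm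
  have hY := Y_pos m hm
  have hP := P_pos m hm
  simp (config := {decide := true}) only [W, h1, h2, h3, hF, if_true, if_false]
  rw [eq_div_iff hP.ne'] at key
  field_simp
  linear_combination key

end PercRepro.PuncturedLYM.Split.TypeLift.TriplesSym
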